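import Literature.AlgebraicGeometry.Resolution.WeakJacobianDerivations
import Literature.AlgebraicGeometry.Resolution.RegularLocalRingsJacobian
import Literature.AlgebraicGeometry.Resolution.DerivativeIdeals
import Literature.AlgebraicGeometry.CossartPiltant200819.DifferentiallyFinite2008
import Mathlib.RingTheory.Localization.AtPrime.Basic
import Mathlib.RingTheory.RegularLocalRing.Polynomial
import Mathlib.Algebra.CharP.Two
import HarnessLib

/-!
# Coefficient derivations of `k[X]`, symbolic squares, and hypersurface regularity at a prime

`Literature/AlgebraicGeometry/Resolution/CoefficientDerivations.lean` (HIRONAKA-L discharge lane, librarian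
res-D-lib-2; DEF-FREE). The generic toolkit behind Zariski's Jacobian criterion over an IMPERFECT ground
field, as used for Hironaka's quadric (CJS Example 18.30; companion file
`Literature/Barriers/ResolutionOfSingularities/DirectrixSmallCharacteristicSingularLocus.lean`):

* §1 `exists_coeffDerivation` — Matsumura's derivations of `k[X_σ]` attached to a derivation of `k`:
  for `δ ∈ Der(k)` there is `Δ ∈ Der(k[X_σ])` with `Δ(C c) = C(δ c)` and `Δ(X_i) = 0`
  [cite: Matsumura1987, Thm. 30.5 (2) p. 234]; in characteristic `2` derivations kill squares
  (`deriv_sq`, `deriv_C_mul_sq`, `deriv_mul_sq`); `deriv_mem_of_mul_mem_sq` (`s ∉ P`, `f ∈ P`,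
  `s f ∈ P²` ⇒ `Δ f ∈ P`, any ring).
* §2 the SYMBOLIC-POWER ↔ LOCALIZATION bridges `(∃ s ∉ P, s·f ∈ Pⁿ) ↔ f/1 ∈ 𝔪_Pⁿ` (both directions,
  any commutative ring; the domain versions of `OrderGenerizationCoheightOne.lean` and the `Hironaka2017/Lib`
  copy are not imported here, to keep this file light) and **`isRegularLocalRing_quotient_iff_forall_mul_not_mem_sq`**:
  for a regular domain `A`, a prime `P` and `0 ≠ f ∈ P`, the local ring `A_P/(f)` of the hypersurface `V(f)`
  at `P` is regular iff `f ∉ P⁽²⁾` [cite: Matsumura1987, Thm. 14.2].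
* §3 the FIELD side in characteristic `2`: `k²(μ) = {a² + μ b²}` is a subfield
  (`exists_subfield_sq_add_mul_sq`), and if `λ ∉ k²(μ)` there is `D ∈ Der(k)` with `Dλ = 1`, `Dμ = 0`
  (`exists_derivation_of_forall_sq_add_mul_sq_ne`, via the tree's `CP2008.exists_derivation_apply_eq_one`,
  Matsumura §26) [cite: Matsumura1987, §26 Thm. 26.5].

Provenance: proofs adapted verbatim (credited) from res-L1-s13-pv-1's Summits-side
`Theorems/Rescue/BedQuadricCJSChain{Toolkit,TwoIndependent}.lean` (p531313 / p533342), which Literature files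
cannot import; hoisted on that seat's LIB-CANDIDATE 2026-08-27T13:13:12Z. All declarations live in the
sub-namespace `Literature.AlgebraicGeometry.Resolution.CoeffDerivation` (open it).
Nothing here is a statement about resolution of singularities.
-/

noncomputable section

open MvPolynomial IsLocalRing

namespace Literature.AlgebraicGeometry.Resolution

namespace CoeffDerivation

universe u

variable {k : Type u} [Field k]

/-! ## §1 Coefficient derivations of `k[X_σ]` -/

/-- **Coefficientwise extension of a derivation of `k` to `k[X_σ]` killing the variables** (Matsumura's
`D_γ ∈ Der(k[X])` attached to a `p`-basis of `k`): for `δ ∈ Der(k)` there is `Δ ∈ Der(k[X_σ])` with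
`Δ(C c) = C(δ c)` and `Δ(X_i) = 0` (tree `MvPolynomial.exists_derivation_C_eq_X_eq`).
[cite: Matsumura1987, Thm. 30.5 (2) p. 234] -/
theorem exists_coeffDerivation {σ : Type*} (δ : Derivation ℤ k k) :
    ∃ Δ : Derivation ℤ (MvPolynomial σ k) (MvPolynomial σ k),
      (∀ c, Δ (C c) = C (δ c)) ∧ ∀ i, Δ (X i) = 0 := by
  obtain ⟨Δ, hC, hX⟩ := MvPolynomial.exists_derivation_C_eq_X_eq (σ := σ)
    (T := MvPolynomial σ k) ((Algebra.linearMap k (MvPolynomial σ k)).compDer δ) (fun _ => (0 : MvPolynomial σ k))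
  refine ⟨Δ, fun c => ?_, hX⟩
  rw [hC]
  change Algebra.linearMap k (MvPolynomial σ k) (δ c) = C (δ c)
  rw [Algebra.linearMap_apply, MvPolynomial.algebraMap_eq]

section DerivationCalculus

variable {σ : Type*} [CharP k 2] {δ : Derivation ℤ k k} {Δ : Derivation ℤ (MvPolynomial σ k) (MvPolynomial σ k)}

/-- In characteristic `2` every derivation kills squares: `Δ(a²) = 2aΔ(a) = 0`.
[cite: Matsumura1987, §25 p. 190 (Der = Der_ℤ; D(aᵖ) = 0 in characteristic p)] -/
theorem deriv_sq (Δ : Derivation ℤ (MvPolynomial σ k) (MvPolynomial σ k)) (a : MvPolynomial σ k) :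
    Δ (a ^ 2) = 0 := by
  rw [pow_two, Derivation.leibniz, smul_eq_mul]
  exact CharTwo.add_self_eq_zero _

/-- `Δ(C c · a²) = C(δ c) · a²` for a coefficient derivation `Δ` over `δ` (characteristic `2`).
[cite: Matsumura1987, Thm. 30.5 (2) p. 234] -/
theorem deriv_C_mul_sq (hC : ∀ c, Δ (C c) = C (δ c)) (c : k) (a : MvPolynomial σ k) :
    Δ (C c * a ^ 2) = C (δ c) * a ^ 2 := by
  rw [Derivation.leibniz, deriv_sq, smul_zero, zero_add, smul_eq_mul, hC, mul_comm]

/-- `Δ(b · a²) = Δ(b) · a²` in characteristic `2`. [cite: Matsumura1987, §25 p. 190 (D(aᵖ) = 0 in characteristic p)] -/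
theorem deriv_mul_sq (Δ : Derivation ℤ (MvPolynomial σ k) (MvPolynomial σ k)) (b a : MvPolynomial σ k) :
    Δ (b * a ^ 2) = Δ b * a ^ 2 := by
  rw [Derivation.leibniz, deriv_sq, smul_zero, zero_add, smul_eq_mul, mul_comm]

end DerivationCalculus

/-- From `s·f ∈ P²`, `f ∈ P`, `s ∉ P` (`P` prime) and a derivation `Δ`: `Δ f ∈ P` (any commutative ring; the
derivation lowers the order along `P` by at most one, `Derivation.apply_mem_pow_sub_one`).
[cite: Matsumura1987, Thm. 30.5 (2) p. 234 (Jacobian criterion via derivations)] -/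
theorem deriv_mem_of_mul_mem_sq {A : Type*} [CommRing A] (Δ : Derivation ℤ A A) {P : Ideal A} [hP : P.IsPrime]
    {s f : A} (hs : s ∉ P) (hf : f ∈ P) (h : s * f ∈ P ^ 2) : Δ f ∈ P := by
  have hD : Δ (s * f) ∈ P := by
    have := Derivation.apply_mem_pow_sub_one ℤ Δ P 2 h
    rwa [show 2 - 1 = 1 from rfl, pow_one] at this
  rw [Derivation.leibniz, smul_eq_mul, smul_eq_mul] at hD
  have hsD : s * Δ f ∈ P := by
    have h' := sub_mem hD (P.mul_mem_right (Δ s) hf)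
    rwa [add_sub_cancel_right] at h'
  exact (hP.mem_or_mem hsD).resolve_left hs

/-! ## §2 Symbolic powers versus powers of `𝔪_P`, and hypersurface regularity at a prime -/

section Bridges

variable {A : Type*} [CommRing A] (P : Ideal A) [P.IsPrime] (S : Type*) [CommRing S] [Algebra A S]
  [IsLocalization.AtPrime S P] [IsLocalRing S]

/-- **Localization bridge** (symbolic power ⇒ power of `𝔪_P`): if `s ∉ P` and `s·f ∈ Pⁿ` then `f/1 ∈ 𝔪_Pⁿ` in `A_P`.
[cite: Matsumura1987, Thm. 4.1 / §6 (P⁽ⁿ⁾ = PⁿA_P ∩ A, symbolic powers)] -/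
theorem algebraMap_mem_maximalIdeal_pow_of_mul_mem {f s : A} {n : ℕ} (hs : s ∉ P) (h : s * f ∈ P ^ n) :
    algebraMap A S f ∈ maximalIdeal S ^ n := by
  have hu : IsUnit (algebraMap A S s) := IsLocalization.map_units S ⟨s, show s ∈ P.primeCompl from hs⟩
  have hmem : algebraMap A S (s * f) ∈ maximalIdeal S ^ n := by
    rw [← IsLocalization.AtPrime.map_eq_maximalIdeal P S, ← Ideal.map_pow]
    exact Ideal.mem_map_of_mem _ h
  rw [map_mul] at hmem
  exact (Ideal.unit_mul_mem_iff_mem _ hu).mp hmem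

/-- **Localization bridge** (power of `𝔪_P` ⇒ symbolic power): if `f/1 ∈ 𝔪_Pⁿ` in `A_P` then `s·f ∈ Pⁿ` for some
`s ∉ P` (any commutative ring `A`). [cite: Matsumura1987, Thm. 4.1 / §6 (P⁽ⁿ⁾ = PⁿA_P ∩ A, symbolic powers)] -/
theorem exists_mul_mem_pow_of_algebraMap_mem {f : A} {n : ℕ} (h : algebraMap A S f ∈ maximalIdeal S ^ n) :
    ∃ s ∉ P, s * f ∈ P ^ n := by
  rw [← IsLocalization.AtPrime.map_eq_maximalIdeal P S, ← Ideal.map_pow,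
    IsLocalization.mem_map_algebraMap_iff P.primeCompl] at h
  obtain ⟨⟨⟨i, hi⟩, ⟨s, hs⟩⟩, hfs⟩ := h
  obtain ⟨⟨t, ht⟩, htt⟩ := (IsLocalization.eq_iff_exists P.primeCompl S).mp
    (show algebraMap A S (f * s) = algebraMap A S i by rw [map_mul]; exact hfs)
  refine ⟨t * s, fun hmem => ?_, ?_⟩
  · rcases ‹P.IsPrime›.mem_or_mem hmem with h1 | h1
    · exact ht h1
    · exact hs h1
  · have : t * s * f = t * (f * s) := by ring
    rw [this, htt]
    exact Ideal.mul_mem_left _ _ hi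

/-- `f ∈ P⁽ⁿ⁾ ↔ f/1 ∈ 𝔪_Pⁿ`. [cite: Matsumura1987, Thm. 4.1 / §6 (P⁽ⁿ⁾ = PⁿA_P ∩ A, symbolic powers)] -/
theorem exists_mul_mem_pow_iff_algebraMap_mem (f : A) (n : ℕ) :
    (∃ s ∉ P, s * f ∈ P ^ n) ↔ algebraMap A S f ∈ maximalIdeal S ^ n :=
  ⟨fun ⟨_, hs, h⟩ => algebraMap_mem_maximalIdeal_pow_of_mul_mem P S hs h,
    exists_mul_mem_pow_of_algebraMap_mem P S⟩

/-- **Hypersurface regularity at a prime** (Matsumura 14.2 both ways): for a regular ring `A` which is a domain, a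
prime `P` and `0 ≠ f ∈ P`, the local ring `A_P/(f)` of the hypersurface `V(f)` at `P` is regular iff `f ∉ P⁽²⁾`, i.e.
iff NO `s ∉ P` has `s·f ∈ P²`. [cite: Matsumura1987, Thm. 14.2] -/
theorem isRegularLocalRing_quotient_iff_forall_mul_not_mem_sq [IsDomain A] [IsRegularRing A] {f : A} (hf0 : f ≠ 0)
    (hfP : f ∈ P) :
    IsRegularLocalRing (Localization.AtPrime P ⧸ Ideal.span {algebraMap A (Localization.AtPrime P) f}) ↔
      ∀ s ∉ P, s * f ∉ P ^ 2 := by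
  have hfm : algebraMap A (Localization.AtPrime P) f ∈ maximalIdeal (Localization.AtPrime P) := by
    rw [← Localization.AtPrime.map_eq_maximalIdeal]
    exact Ideal.mem_map_of_mem _ hfP
  constructor
  · intro hreg s hs hsf
    have hf0' : algebraMap A (Localization.AtPrime P) f ≠ 0 := fun h0 =>
      hf0 (IsLocalization.injective (Localization.AtPrime P) P.primeCompl_le_nonZeroDivisors
        (by rw [h0, map_zero]))
    exact not_isRegularLocalRing_quotient_span_singleton_of_mem_sq hf0'
      (algebraMap_mem_maximalIdeal_pow_of_mul_mem P (Localization.AtPrime P) hs hsf) hreg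
  · intro h
    refine (IsRegularLocalRing.quotient_span_singleton hfm fun hsq => ?_).1
    obtain ⟨s, hs, hsf⟩ := exists_mul_mem_pow_of_algebraMap_mem P (Localization.AtPrime P) hsq
    exact h s hs hsf

/-- Corollary: `A_P/(f)` is NOT regular iff `f ∈ P⁽²⁾`. [cite: Matsumura1987, Thm. 14.2] -/
theorem not_isRegularLocalRing_quotient_iff_exists_mul_mem_sq [IsDomain A] [IsRegularRing A] {f : A}
    (hf0 : f ≠ 0) (hfP : f ∈ P) :
    ¬ IsRegularLocalRing (Localization.AtPrime P ⧸ Ideal.span {algebraMap A (Localization.AtPrime P) f}) ↔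
      ∃ s ∉ P, s * f ∈ P ^ 2 := by
  rw [isRegularLocalRing_quotient_iff_forall_mul_not_mem_sq P hf0 hfP]
  push Not
  exact Iff.rfl

end Bridges

/-! ## §3 Characteristic `2`: the subfield `k²(μ)` and derivations dual to a `2`-independent pair -/

section FieldSide

variable [CharP k 2]

/-- In characteristic `2`, the elements `a² + μb²` (`a, b ∈ k`) form a SUBFIELD of `k` (it is `k²(μ)`): closed under
`+` (Frobenius is additive), `·` (`(a²+μb²)(c²+μd²) = (ac+μbd)² + μ(ad+bc)²`), and inverses (`x⁻¹ = x·(x⁻¹)²`).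
[cite: Matsumura1987, §26 (k^p(x₁,…,x_n), p-bases) ] -/
theorem exists_subfield_sq_add_mul_sq (m : k) :
    ∃ E : Subfield k, (∀ x : k, x ∈ E ↔ ∃ a b : k, x = a ^ 2 + m * b ^ 2) := by
  refine ⟨{ carrier := {x | ∃ a b : k, x = a ^ 2 + m * b ^ 2}
            mul_mem' := ?_, one_mem' := ⟨1, 0, by ring⟩, add_mem' := ?_, zero_mem' := ⟨0, 0, by ring⟩,
            neg_mem' := ?_, inv_mem' := ?_ }, fun x => Iff.rfl⟩
  · rintro _ _ ⟨a, b, rfl⟩ ⟨c, d, rfl⟩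
    refine ⟨a * c + m * (b * d), a * d + b * c, ?_⟩
    linear_combination (-(m * (a * d) * (b * c)) - m * (a * c) * (b * d)) * CharTwo.two_eq_zero (R := k)
  · rintro _ _ ⟨a, b, rfl⟩ ⟨c, d, rfl⟩
    refine ⟨a + c, b + d, ?_⟩
    linear_combination (-(a * c) - m * (b * d)) * CharTwo.two_eq_zero (R := k)
  · rintro _ ⟨a, b, rfl⟩
    refine ⟨a, b, ?_⟩
    linear_combination (-(a ^ 2) - m * b ^ 2) * CharTwo.two_eq_zero (R := k)
  · rintro _ ⟨a, b, rfl⟩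
    refine ⟨a * (a ^ 2 + m * b ^ 2)⁻¹, b * (a ^ 2 + m * b ^ 2)⁻¹, ?_⟩
    by_cases h0 : a ^ 2 + m * b ^ 2 = 0
    · rw [h0]; simp
    · field_simp

/-- **A derivation dual to `λ` over `k²(μ)`**: in characteristic `2`, if `λ ∉ k²(μ) = {a² + μb²}` then there is
`D ∈ Der(k)` with `Dλ = 1` and `Dμ = 0` (Matsumura §26: for `x ∉ E ⊇ kᵖ` there is an `E`-derivation of `k` with
`Dx = 1`; the tree's Zorn-lemma construction `CP2008.exists_derivation_apply_eq_one`).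
[cite: Matsumura1987, §26 Thm. 26.5 and its proof] -/
theorem exists_derivation_of_forall_sq_add_mul_sq_ne {l m : k} (hl : ∀ a b : k, a ^ 2 + m * b ^ 2 ≠ l) :
    ∃ D : Derivation ℤ k k, D l = 1 ∧ D m = 0 := by
  haveI : Fact (Nat.Prime 2) := ⟨Nat.prime_two⟩
  obtain ⟨E, hE⟩ := exists_subfield_sq_add_mul_sq (k := k) m
  have hpow : ∀ y : k, ∃ b : E, algebraMap E k b = y ^ 2 :=
    fun y => ⟨⟨y ^ 2, (hE _).mpr ⟨y, 0, by ring⟩⟩, rfl⟩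
  have hl' : l ∉ Set.range (algebraMap E k) := by
    rintro ⟨⟨x, hx⟩, hxl⟩
    obtain ⟨a, b, rfl⟩ := (hE x).mp hx
    exact hl a b hxl
  obtain ⟨D, hD⟩ := Literature.AlgebraicGeometry.CossartPiltant200819.CP2008.exists_derivation_apply_eq_one (E := E) (k := k) (p := 2) hpow hl'
  have hm : m ∈ E := (hE m).mpr ⟨0, 1, by ring⟩
  refine ⟨D.restrictScalars ℤ, hD, ?_⟩
  change D m = 0
  have : (m : k) = algebraMap E k ⟨m, hm⟩ := rfl
  rw [this, Derivation.map_algebraMap]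

/-- In characteristic `2` every derivation of `k` kills squares. [cite: Matsumura1987, §25 p. 190 (D(aᵖ) = 0 in characteristic p)] -/
theorem derivation_apply_sq_eq_zero (D : Derivation ℤ k k) (a : k) : D (a ^ 2) = 0 := by
  rw [pow_two, Derivation.leibniz, smul_eq_mul]
  exact CharTwo.add_self_eq_zero _

end FieldSide

end CoeffDerivation

end Literature.AlgebraicGeometry.Resolution
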